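import Literature.NumberTheory.DiophantineGeometry.GenEllThm21
import Literature.NumberTheory.DiophantineGeometry.GenEllNorthcott
import Literature.NumberTheory.DiophantineGeometry.GenEllProjLineInvariance
import HarnessLib

/-!
# [GenEll] Thm 2.1 for `ℙ¹ ∖ {0,1,∞}`: the inequality of BD-classes ignores Galois-finite sets

S. Mochizuki, *Arithmetic elliptic curves in general position* [cite: MochizukiGenEll2010, Thm 2.1 p.11].
In the proof of Thm. 2.1 (p. 12: "[after possibly eliminating finitely many elements from `Ξ`]")
and throughout [IUTchIV] Cor. 2.2 (p. 42: "there exists a finite subset `Exc_d ⊆ U_X(Q̄)^{≤d}` …";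
the function `log(q^∀)` "is `≤ H_unif·ε_d^{-3}·d^{4+ε_d} + H_K` on `Exc_d`") finitely many Q̄-points
are discarded from an inequality of BD-classes. This file supplies that bookkeeping for the Lean
rendering (`VojtaIneq S d ε` of `GenEllThm21.lean`), where points are PRESENTED as pairs `(F, x)`
and one Q̄-point has infinitely many (isomorphic) presentations:

* `vojtaIneq_mono`, `vojtaIneq_union` — the inequality restricts to subsets and glues over unions;
* `vojtaIneq_of_ht_le` — it holds on any set on which the height is bounded (log-diff, log-cond are
  nonnegative), which is how [IUTchIV] Cor. 2.2 (ii) USES its exceptional sets;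
* `exists_ringEquiv_of_mpoly_eq` — two minimal presentations with the same minimal polynomial are
  isomorphic (`ℚ(x) ≅ ℚ[T]/(m_x) ≅ ℚ(x')`), hence (`GenEllProjLineInvariance`) have the same height,
  log-different and log-conductor;
* `vojtaIneq_of_hasFinitelyManyPoints` — the inequality holds on every set with finitely many
  Q̄-points (finitely many minimal polynomials, `HasFinitelyManyPoints` of `GenEllNorthcott.lean`);
  so `VojtaIneq (S \\ E) d ε → VojtaIneq S d ε` whenever `E` is Galois-finite (`vojtaIneq_of_diff`).
-/

noncomputable section

open NumberField IsDedekindDomain Height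

namespace Literature.NumberTheory.DiophantineGeometry.GenEll

variable {S T : Set NFPoint} {d : ℕ} {ε : ℝ}

/-- The inequality of BD-classes restricts to subsets. [cite: MochizukiGenEll2010, Thm 2.1 p.11] -/
theorem vojtaIneq_mono (h : VojtaIneq T d ε) (hST : S ⊆ T) : VojtaIneq S d ε :=
  BDLe.mono h (Set.inter_subset_inter_left _ hST)

/-- The inequality of BD-classes on `S` and on `T` gives it on `S ∪ T`.
[cite: MochizukiGenEll2010, Thm 2.1 p.11] -/
theorem vojtaIneq_union (hS : VojtaIneq S d ε) (hT : VojtaIneq T d ε) : VojtaIneq (S ∪ T) d ε := by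
  unfold VojtaIneq at *
  rw [Set.union_inter_distrib_right]
  exact bdLe_union_iff.mpr ⟨hS, hT⟩

/-- The inequality of BD-classes holds on any set on which the height is bounded (the right-hand
side is nonnegative). This is how [IUTchIV] Cor. 2.2 (ii) uses its exceptional sets `Exc_d`
("`log(q^∀)` … is `≤ H` on `Exc_d`"). [cite: MochizukiGenEll2010, Thm 2.1 p.11] -/
theorem vojtaIneq_of_ht_le {H : ℝ} (hε : 0 ≤ 1 + ε) (h : ∀ P ∈ S ∩ UPle d, P.ht ≤ H) :
    VojtaIneq S d ε := by
  refine ⟨H, fun P hP => ?_⟩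
  have h1 := h P hP
  have h2 : 0 ≤ (1 + ε) * (P.logDiff + P.logCond) :=
    mul_nonneg hε (add_nonneg P.logDiff_nonneg P.logCond_nonneg)
  change P.ht - (1 + ε) * (P.logDiff + P.logCond) ≤ H
  linarith

/-- **Two minimal presentations with the same minimal polynomial are isomorphic**, by an
isomorphism matching the presented coordinates: `ℚ(x) ≅ ℚ[T]/(m) ≅ ℚ(x')`.
[cite: MochizukiGenEll2010, Def 1.5 (i) p.8] -/
theorem exists_ringEquiv_of_mpoly_eq {P Q : NFPoint} (hP : P.IsMinimal) (hQ : Q.IsMinimal)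
    (h : P.mpoly = Q.mpoly) : ∃ e : P.F ≃+* Q.F, e P.x = Q.x := by
  have hiP : IsIntegral ℚ P.x := Algebra.IsIntegral.isIntegral P.x
  have hiQ : IsIntegral ℚ Q.x := Algebra.IsIntegral.isIntegral Q.x
  -- power bases of `P.F`, `Q.F` generated by `P.x`, `Q.x`
  let eP : IntermediateField.adjoin ℚ ({P.x} : Set P.F) ≃ₐ[ℚ] P.F :=
    (IntermediateField.equivOfEq hP).trans IntermediateField.topEquiv
  let eQ : IntermediateField.adjoin ℚ ({Q.x} : Set Q.F) ≃ₐ[ℚ] Q.F :=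
    (IntermediateField.equivOfEq hQ).trans IntermediateField.topEquiv
  let pbP : PowerBasis ℚ P.F := (IntermediateField.adjoin.powerBasis hiP).map eP
  let pbQ : PowerBasis ℚ Q.F := (IntermediateField.adjoin.powerBasis hiQ).map eQ
  have hgP : pbP.gen = P.x := by
    change eP (IntermediateField.adjoin.powerBasis hiP).gen = P.x
    rw [IntermediateField.adjoin.powerBasis_gen]; rfl
  have hgQ : pbQ.gen = Q.x := by
    change eQ (IntermediateField.adjoin.powerBasis hiQ).gen = Q.x
    rw [IntermediateField.adjoin.powerBasis_gen]; rfl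
  have hmin : minpoly ℚ pbP.gen = minpoly ℚ pbQ.gen := by
    rw [hgP, hgQ]; exact h
  refine ⟨(pbP.equivOfMinpoly pbQ hmin).toRingEquiv, ?_⟩
  change (pbP.equivOfMinpoly pbQ hmin) P.x = Q.x
  rw [← hgP, PowerBasis.equivOfMinpoly_gen, hgQ]

/-- Minimal presentations with equal minimal polynomials have equal height, log-different and
log-conductor. [cite: MochizukiGenEll2010, Def 1.5 p.8] -/
theorem values_eq_of_mpoly_eq {P Q : NFPoint} (hP : P.IsMinimal) (hQ : Q.IsMinimal)
    (h : P.mpoly = Q.mpoly) : P.ht = Q.ht ∧ P.logDiff = Q.logDiff ∧ P.logCond = Q.logCond := by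
  obtain ⟨e, he⟩ := exists_ringEquiv_of_mpoly_eq hP hQ h
  exact ⟨NFPoint.ht_eq_of_ringEquiv e he, NFPoint.logDiff_eq_of_ringEquiv e,
    NFPoint.logCond_eq_of_ringEquiv e he⟩

/-- **The inequality of BD-classes holds on every set with finitely many Q̄-points** (finitely many
minimal polynomials among its minimally presented points of degree `≤ d`): the height takes finitely
many values there. [cite: MochizukiGenEll2010, Thm 2.1 p.11] -/
theorem vojtaIneq_of_hasFinitelyManyPoints (hε : 0 ≤ 1 + ε) (hfin : HasFinitelyManyPoints (S ∩ UPle d)) :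
    VojtaIneq S d ε := by
  classical
  -- the height factors through the minimal polynomial on `S ∩ UPle d`
  have hval : ∀ P ∈ S ∩ UPle d, ∀ Q ∈ S ∩ UPle d, P.mpoly = Q.mpoly → P.ht = Q.ht :=
    fun P hP Q hQ h => (values_eq_of_mpoly_eq hP.2.1.2 hQ.2.1.2 h).1
  -- finitely many values of `ht`
  have himg : (NFPoint.ht '' (S ∩ UPle d)).Finite := by
    have hsub : NFPoint.ht '' (S ∩ UPle d) ⊆
        (fun f => if hf : ∃ P ∈ S ∩ UPle d, P.mpoly = f then (Classical.choose hf).ht else 0) ''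
          (NFPoint.mpoly '' (S ∩ UPle d)) := by
      rintro _ ⟨P, hP, rfl⟩
      refine ⟨P.mpoly, ⟨P, hP, rfl⟩, ?_⟩
      have hf : ∃ P' ∈ S ∩ UPle d, P'.mpoly = P.mpoly := ⟨P, hP, rfl⟩
      simp only [dif_pos hf]
      obtain ⟨hmem, heq⟩ := Classical.choose_spec hf
      exact hval _ hmem _ hP heq
    exact (hfin.image _).subset hsub
  obtain ⟨H, hH⟩ := himg.bddAbove
  exact vojtaIneq_of_ht_le hε fun P hP => hH ⟨P, hP, rfl⟩

/-- Discarding a Galois-finite set of points does not affect the inequality of BD-classes: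
if it holds off `E` and `E ∩ U_P(Q̄)^{≤d}` has finitely many points, it holds everywhere.
[cite: MochizukiGenEll2010, Thm 2.1 p.11] -/
theorem vojtaIneq_of_diff {E : Set NFPoint} (hε : 0 ≤ 1 + ε)
    (hE : HasFinitelyManyPoints (E ∩ UPle d)) (h : VojtaIneq (S \ E) d ε) : VojtaIneq S d ε := by
  have hSE : VojtaIneq (S ∩ E) d ε :=
    vojtaIneq_of_hasFinitelyManyPoints hε (hE.mono (by
      intro P hP; exact ⟨hP.1.2, hP.2⟩))
  have := vojtaIneq_union h hSE
  exact vojtaIneq_mono this (fun P hP => by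
    by_cases hPE : P ∈ E
    · exact Or.inr ⟨hP, hPE⟩
    · exact Or.inl ⟨hP, hPE⟩)

end Literature.NumberTheory.DiophantineGeometry.GenEll

end
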